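import Summits.ResolutionOfSingularities.ResolutionOfSingularities.Theorems.FrobeniusLadderFInjectiveMacaulayficationPConeGradedFiModel
import Summits.ResolutionOfSingularities.ResolutionOfSingularities.Theorems.FrobeniusLadderFInjectiveMacaulayficationPConeOffVertex
import HarnessLib

/-!
# G6ᵍ-P (char 5): the P-cone has an F-injective Macaulayfication — unconditional (crux `FInjectiveMacaulayfication`, line H4-gd)

Support file for crux stmt-ResolutionOfSingularities-15315 (`FrobeniusLadder.FInjectiveMacaulayfication`), line (H4-gd), calibration
G6ᵍ-P (CRUX-PLAN w45a v9 R9.3). [OURS · L1 W4.5a] AI-written; AI review is weaker than expert review. No statement of Hironaka2017 is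
used; no external fact is consumed.

THE FIRST CODIMENSION-2 CALIBRATION OF THE CRUX: for every field `k` of characteristic `5`, the cone
`P = Spec k[x,y,w,Z,U]/(x²+y³−wU, Z²+wU³+w³)` (res-L1-w45a-idea-2's residual point of the STRONG⁺ step on `f_cusp/𝔽₅`; not F-pure at
the vertex, singular along the two cones `L ∪ C′`) has a proper birational model all of whose stalks are integral domains satisfying
the per-stalk clause of `FrobeniusLadder.FInjectiveMacaulayfication` (Cohen–Macaulay + every parameter ideal Frobenius closed): the
weighted blow-up of `I₅₄₀`. Assembly: `PConeGradedFiModel.pConeGradedFiModel_of_offVertex` (res-L1-w45a-stub-2: engine p500711, Veronese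
splitting p504872, primality p508052) + the clause off the vertex `PConeOffVertex.pCone_offVertex_clause_char5` (res-L1-w45a-stub-4,
p507655, K-P; its ideal `Ideal.span {r | r ∈ [F₁, F₂]}` is rewritten to `Ideal.span {F₁, F₂}`). No definitions, no named facts.
[folklore shape: cone over an F-injective CM base]
-/

set_option linter.dupNamespace false

open AlgebraicGeometry CategoryTheory Literature.AlgebraicGeometry.Resolution MvPolynomial

namespace Summit.ResolutionOfSingularities.ResolutionOfSingularities.Theorems.FInjectiveMacaulayfication.PConeGradedFiModelChar5

open Summit.ResolutionOfSingularities.ResolutionOfSingularities.Theorems.FInjectiveMacaulayfication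

/-- **G6ᵍ-P, `char k = 5` (unconditional).** `Spec k[x,y,w,Z,U]/(x²+y³−wU, Z²+wU³+w³)` has a proper birational model with
integral stalks satisfying the crux clause at every point — the first calibration of `FInjectiveMacaulayfication` in embedding
codimension `2` (graded-domain engine ∘ Veronese splitting ∘ primality ∘ K-P). [folklore] -/
theorem pConeGradedFiModel_char5 (k : Type) [Field k] [CharP k 5] (F₁ F₂ : MvPolynomial (Fin 5) k)
    (h₁ : F₁ = X 0 ^ 2 + X 1 ^ 3 - X 2 * X 4) (h₂ : F₂ = X 3 ^ 2 + X 2 * X 4 ^ 3 + X 2 ^ 3) :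
    ∃ (X' : Scheme.{0}) (π : X' ⟶ Spec (.of (MvPolynomial (Fin 5) k ⧸ Ideal.span {F₁, F₂}))), IsProper π ∧
      Literature.AlgebraicGeometry.Resolution.IsBirational π ∧
      ∀ y : X', IsDomain (X'.presheaf.stalk y) ∧ ∀ d : ℕ, ringKrullDim (X'.presheaf.stalk y) = d →
        ∀ s : Fin d → X'.presheaf.stalk y, (Ideal.span (Set.range s)).radical.IsMaximal →
          RingTheory.Sequence.IsWeaklyRegular (X'.presheaf.stalk y) (List.ofFn s) ∧
          ∀ z : X'.presheaf.stalk y, (∃ e : ℕ, z ^ 5 ^ e ∈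
              Ideal.span ((fun w : X'.presheaf.stalk y => w ^ 5 ^ e) ''
                (Ideal.span (Set.range s) : Set (X'.presheaf.stalk y)))) →
            z ∈ Ideal.span (Set.range s) := by
  haveI : Fact (Nat.Prime 5) := ⟨Nat.prime_five⟩
  have hset : ({r | r ∈ [F₁, F₂]} : Set (MvPolynomial (Fin 5) k)) = {F₁, F₂} := by
    ext r
    simp
  have hoff := PConeOffVertex.pCone_offVertex_clause_char5 k F₁ F₂ h₁ h₂
  rw [hset] at hoff
  exact PConeGradedFiModel.pConeGradedFiModel_of_offVertex 5 k F₁ F₂ h₁ h₂ hoff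

end Summit.ResolutionOfSingularities.ResolutionOfSingularities.Theorems.FInjectiveMacaulayfication.PConeGradedFiModelChar5
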